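import HarnessLib.Audit.LibrarySuggestionsDenyListCorCM
import Summits.HodgeConjecture.CorCM.HypLiu418.A3Liu418GSThmD6OneCurve
import Summits.HodgeConjecture.CorCM.HypLiu418.A3Liu418GSInstance
import Literature.NumberTheory.Automorphic.Liu2021.AppendixC.OmegaHomBettiComparisonRank
import Literature.NumberTheory.Automorphic.Liu2021.AppendixC.BettiComparisonOfPinning
import Literature.NumberTheory.Automorphic.Liu2021.AppendixC.H1ComparisonFamilyHolds
import Literature.NumberTheory.Automorphic.Liu2021.AppendixC.EtaleH1TowerCMQuotient
import Literature.NumberTheory.Automorphic.PicardCMEigenbasis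
import Literature.AlgebraicGeometry.HodgeTheory.HodgeTypeExteriorProduct
import Literature.AlgebraicGeometry.HodgeTheory.HodgeTypeVanishing
import Literature.AlgebraicGeometry.Motives.AbelianVarietyProjective
import HarnessLib

/-!
# F0 · P5 (Alb-CM) — the TRANSFER stub `stub_S1b_transfer : S1PinningShape → S1bHodgeShape → S1bShape`, PROVED

Cell `hodgecm-mathlib` (D-0151), floor 0, programme P5 (Alb-CM ∕ [Liu2021, Thm. 4.15]); crux item `stmt-HodgeConjecture-24832`
(`Summit.HodgeConjecture.HodgeConjecture.Theses.HCCMUnconditional.HLiu418`).  Line of record: `Cruxes/HLiu418/Lines/F0_AlbCm.lean`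
(F0P5-plan (g0), HOME `F0/P5/line-F0_AlbCm.lean` sha16 aa33d9dcff10dace; registrar A-plan2 (g16)), stub B3 of PLAN-F0P5 v1.

THIS FILE closes that stub: `stubS1bTransfer_holds` (§2) states `S1PinningShape → S1bHodgeShape → S1bShape` with ALL THREE TYPES RESTATED
VERBATIM — the two hypotheses from the line (:139–:145, :158–:200) and the conclusion from the registered d6 letter `S1bShape`
(`Cruxes/HLiu418/Lines/D6CmCurveBodyA.lean` :1325–:1377, namespace `Summit.HodgeConjecture.CorCM.Lines.A3Liu418`) with its one registry-side
`def` `D6Glue.blockValues C ℓ X ι ω` δ-unfolded to `{y | ∃ f ∈ X.omegaHom ι ω, ∃ w, f w = y}` — because a `Theorems/` file may not import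
`Cruxes.*` modules (gate `lint.import`; director s347 ∕ s355 shape: no `def … : Prop`, no socket here).  The line's edition 2 reads
`theorem stub_S1b_transfer : S1PinningShape → S1bHodgeShape → S1bShape := F0P5StubS1bTransfer.stubS1bTransfer_holds` — CERTIFIED by paste
against the line's own two `def`s and ★ `S1bShape` BY NAME at default heartbeats (HOME `A-provers/A-p12/g12/CERT-B3-lineOneLiner.bypaste.A-p12g12.lean`).  The WORK is done once, GENERICALLY (§1′ `exists_mem_eigenline_isOfHodgeType_of_isotypic`: any §4.2
datum `C`, translates `T`, induced étale Hecke datum `X`, pinned Betti tower, `ℂ[𝔾]`-module `ω`, test proposition `P`), so that the sister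
lines (GSM ∕ untwisted towers) reuse it; §2 is `intro`s + the pinning + ONE application (the only cross-file unification: the `ω⋆_lab`-isotypic
part as elaborated in `D6CmCurveBodyA` against the restated `S1bHodgeShape` body — default heartbeats suffice).

STATEMENT IN WORDS. `S1bShape` ([Liu2021, Prop. D.4 (1) clause (2) ∕ Rem. D.5] on a CM quotient): for the face data, a level `K`,
`φ : A_K ⟶ B`, a CM field `M` acting RATIONALLY on `B` (`[M:ℚ] = 2 dim B`), `τ : M → ℂ` and `f ∈ ℚ̄_ℓ ⊗ (V_ℓ B)^∨` on the `(ι' ∘ τ)`-eigenline with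
`([·]_K ∘ ᵗV_ℓ φ) f` a NON-ZERO element of the span of the `ω⋆`-block of `ℚ̄_ℓ ⊗ H¹_ét(A_∞)`: on every principal model `(B′, ρ, Φ)` of `(B, i)` and
every realisation `θ` of `(B′ ×_{ι₁} ℂ, ρ_ℂ)` of type `Φ`, SOME non-zero `θ`-`τ`-eigenvector is of type `(1,0)` if `ι₁ ∈ Φ_μ`, `(0,1)` if not.
HYPOTHESES: `S1PinningShape` (a Betti pinning of the GS tower along `ι₁` exists), `S1bHodgeShape` (level classes with `ω⋆`-isotypic image are typed).

## Proof ([Liu2021] §4.2 l. 2152–2168 and the proof of Thm. D.6 (1), p. 140, made explicit; every input is a ★ theorem of the tree)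

1. ÉTALE TRANSPORT to the principal model (★ `EtaleH1TowerCMQuotient`): `f′ := ᵗV_ℓ(v′) f` is a `ρ`-eigenvector
   (`dualMap_rationalTateAction_endAlgebraTransport_baseChange_eq_smul`, `rationalTateAction_of`) and `ᵗV_ℓ(u′) f′ = m • f`
   (`dualMap_baseChange_comp_of_comp_eq_nsmul`).
2. COMPARISON: the levelwise comparison family `c` along `(ι₁, ι')` (★ `exists_h1ComparisonFamily_holds`, [SGA4 XI 4.4]), the pinning
   `(H, rhoB, b)` of `S1PinningShape`, and the colimit comparison `cmp` of ★ `BettiPinning.exists_bettiComparison` for the étale Hecke datum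
   ★ `etaleHeckeDatumGS` (induced by the translates, ★ `isInducedBy_etaleHeckeDatumGS`): `cmp (b_K y) = ([·]_K ⊗ 1) (c_{A_K} y)`.
3. BETTI CLASS on `B′`: `y′ := c_{B′}⁻¹ f′` (`c.bijective`).  By the realisation clause `θ a = (ρ a)_ℂ^*` (= `bettiPullAlong ι₁ (ρ a)`, `rfl`),
   naturality of `c` in `ρ a` and step 1, `θ a y′ = τ a • y′` for `a ∈ 𝓞_M`, hence on `M` (★ `PicardCM.mem_eigenline_of_forall_integer`);
   `y′ ≠ 0` because `ᵗV_ℓ(u′) f′ = m f` has non-zero pull-back.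
4. LEVEL CLASS `z := φ^* u′^* y′ ∈ H¹_B(A_K ×_{ι₁} ℂ)`: by naturality (twice) and step 1, `([·]_K ⊗ 1)(c_{A_K} z) = m • ([·]_K ∘ ᵗV_ℓ φ) f`, which is
   non-zero and lies in the span of the block; §1's generic lemma `mem_iSup_range_of_cmp_mem_span_blockValues` («`cmp h ∈ span blockValues ⇒ h`
   is `ω`-isotypic», from ★ `BettiComparison.exists_comp_eq` and the `ι'`-semilinearity of `cmp` along the ISOMORPHISM `ι'`) makes `b_K z`
   isotypic, so `S1bHodgeShape` types `z`: `(1,0)` if `ι₁ ∈ Φ_μ`, `(0,1)` if not.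
5. READ-OFF: `y′` lies on the `τ`-eigenline of the realisation, which is pure of type `(1,0)` if `τ ∈ Φ` and `(0,1)` if `τ ∉ Φ`; pull-backs along
   morphisms of smooth projective varieties preserve types (★ `IsOfHodgeType.map_of_isSmoothProjective`, ★ `isSmoothProjective_holds`,
   ★ `dim_baseChange`), and a non-zero class has at most one type (★ `IsOfHodgeType.eq_zero_of_ne`); so the type of `y′` is the type `S1bHodgeShape`
   gave `z ≠ 0`.  Witness `v := y′`.  (No surjectivity of `φ` is needed.)

HONEST LABEL: HC_CM is proved only modulo the 7 printed citations until rung 0 closes; this file discharges none of them — it is an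
UNCONDITIONAL transfer between two floor-0 stubs and the registered d6 letter `S1bShape` (theorems only; no `def`, no named fact, no `sorry`).

## References
* [Liu2021] Y. Liu, Camb. J. Math. 9 (2021) = arXiv:2102.11518: §4.2 (l. 2152–2168), Prop. D.4 (1) p. 130, Rem. D.5 p. 131, Thm. D.6 (1) proof p. 140.
* [SGA4Tome3] M. Artin, A. Grothendieck, J.-L. Verdier, SGA 4 Tome 3, Exp. XI Thm. 4.4 (comparison, carried by ★ `H1ComparisonFamilyHolds`).
* [Shimura1998] G. Shimura, *Abelian Varieties with CM and Modular Functions*, §5.2; [Voisin2002] C. Voisin, *Hodge Theory I*, §7.3.2, Cor. 6.14.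
* Tree: registry `Cruxes/HLiu418/Lines/D6CmCurveBodyA` (`S1bShape`, `D6Glue.blockValues` — restated, not imported), ★ `AppendixC.{EtaleBettiComparison,
  BettiComparisonOfPinning, OmegaHomBettiComparisonRank, H1ComparisonFamilyHolds, EtaleH1TowerCMQuotient}`, ★ `CorCM.HypLiu418.{A3Liu418GSInstance,
  A3Liu418GSThmD6OneCurve}` (`sec42DataGS`, `etaleHeckeDatumGS`, `isInducedBy_etaleHeckeDatumGS`, `hsChiGS`), ★ `HodgeTheory.{HodgeTypeExteriorProduct,
  HodgeTypeVanishing}`, ★ `Automorphic.PicardCMEigenbasis`, ★ `Motives.AbelianVarietyProjective` (`dim_baseChange`).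
-/

open scoped TensorProduct

/-! ## §1 Generic: the comparison pulls the span of the block back to the isotypic part -/

namespace Summit.HodgeConjecture.HodgeConjecture.Cruxes.HLiu418.F0P5StubS1bTransfer

set_option linter.dupNamespace false  -- `Summit.HodgeConjecture.HodgeConjecture.…` BY DESIGN (D-0017)

section Generic

open CategoryTheory NumberField
open Literature.NumberTheory.Automorphic.Liu2021 Literature.NumberTheory.Automorphic.Liu2021.AppendixC

variable {F E : Type} [Field F] [NumberField F] [IsTotallyReal F] [Field E] [NumberField E] [Algebra F E]
  [IsTotallyComplex E] [Algebra.IsQuadraticExtension F E]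
variable {P5 : PropC5Data F E} {isotropicAt : ℕ → Prop}
variable {C : Sec42Data P5 isotropicAt} {ℓ : ℕ} [Fact ℓ.Prime] {X : C.EtaleHeckeDatum ℓ}
  {H : Type} [AddCommGroup H] [Module ℂ H] {rhoB : Representation ℂ C.G H} {ι : ℂ ≃+* AlgebraicClosure ℚ_[ℓ]}
  {W : Type} [AddCommGroup W] [Module ℂ W]

/-- **The comparison pulls the `ℚ̄_ℓ`-span of the `ω`-block back to the `ω`-isotypic part.**  For a colimit comparison
`cmp : H →ₛₗ[ι] ℚ̄_ℓ ⊗ H¹_ét(A_∞)` (★ `Sec42Data.BettiComparison`) and a `ℂ[𝔾]`-module `(W, ρW)`: if `cmp h` lies in the `ℚ̄_ℓ`-span of the block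
`{f w | f ∈ Hom_{ℚ̄_ℓ[𝔾]}(ι ∘ ω, ℚ̄_ℓ ⊗ H¹_ét), w ∈ W}` (the registry's `D6Glue.blockValues`, written out), then `h ∈ ⨆_ψ range ψ`, `ψ` over the `ℂ[𝔾]`-maps `ω → H` — every
`f` is `cmp ∘ ψ` (★ `BettiComparison.exists_comp_eq`), the image of the `ℂ`-submodule `⨆ range ψ` under the `ι`-semilinear `cmp` is a
`ℚ̄_ℓ`-submodule because `ι` is ONTO, and `cmp` is injective. [cite: Liu2021, §4.2 (FJcycle.tex l. 2152–2165)] -/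
theorem mem_iSup_range_of_cmp_mem_span_blockValues (cmp : C.BettiComparison ℓ X H rhoB ι)
    (ρW : Representation ℂ C.G W) {h : H}
    (hh : cmp.cmp h ∈ Submodule.span (AlgebraicClosure ℚ_[ℓ]) {y | ∃ f ∈ X.omegaHom ι ρW, ∃ w : W, f w = y}) :
    h ∈ ⨆ ψ : Representation.IntertwiningMap ρW rhoB, LinearMap.range ψ.toLinearMap := by
  -- the image of the isotypic part under `cmp`, a `ℚ̄_ℓ`-submodule since `ι` is onto
  let N : Submodule ℂ H := ⨆ ψ : Representation.IntertwiningMap ρW rhoB, LinearMap.range ψ.toLinearMap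
  let N' : Submodule (AlgebraicClosure ℚ_[ℓ]) (AlgebraicClosure ℚ_[ℓ] ⊗[ℚ_[ℓ]] C.etaleH1Tower ℓ) :=
    { carrier := {t | ∃ x ∈ N, cmp.cmp x = t}
      zero_mem' := ⟨0, N.zero_mem, map_zero _⟩
      add_mem' := by
        rintro _ _ ⟨x₁, hx₁, rfl⟩ ⟨x₂, hx₂, rfl⟩
        exact ⟨x₁ + x₂, N.add_mem hx₁ hx₂, map_add _ _ _⟩
      smul_mem' := by
        rintro b _ ⟨x, hx, rfl⟩
        refine ⟨ι.symm b • x, N.smul_mem _ hx, ?_⟩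
        rw [LinearMap.map_smulₛₗ, RingEquiv.coe_toRingHom, RingEquiv.apply_symm_apply] }
  have hle : Submodule.span (AlgebraicClosure ℚ_[ℓ]) {y | ∃ f ∈ X.omegaHom ι ρW, ∃ w : W, f w = y} ≤ N' := by
    refine Submodule.span_le.2 ?_
    rintro _ ⟨f, hf, w, rfl⟩
    obtain ⟨φ, hφ⟩ := cmp.exists_comp_eq ρW hf
    refine ⟨φ w, Submodule.mem_iSup_of_mem φ (LinearMap.mem_range.2 ⟨w, rfl⟩), ?_⟩
    rw [← hφ]
    rfl
  obtain ⟨x, hx, hxh⟩ := hle hh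
  rwa [← cmp.injective hxh]

/-- The same with the comparison image given by an equation `cmp h = t`, `t` in the span of the block (the form the transfer uses: the
membership hypothesis is taken AS ELABORATED by its producer, no rewriting inside it). [cite: Liu2021, §4.2 (FJcycle.tex l. 2152–2165)] -/
theorem mem_iSup_range_of_cmp_eq_of_mem_span_blockValues (cmp : C.BettiComparison ℓ X H rhoB ι)
    (ρW : Representation ℂ C.G W) {h : H} {t : AlgebraicClosure ℚ_[ℓ] ⊗[ℚ_[ℓ]] C.etaleH1Tower ℓ}
    (ht : t ∈ Submodule.span (AlgebraicClosure ℚ_[ℓ]) {y | ∃ f ∈ X.omegaHom ι ρW, ∃ w : W, f w = y}) (he : cmp.cmp h = t) :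
    h ∈ ⨆ ψ : Representation.IntertwiningMap ρW rhoB, LinearMap.range ψ.toLinearMap :=
  mem_iSup_range_of_cmp_mem_span_blockValues cmp ρW (he ▸ ht)

/-! ## §1′ Generic core: Hodge type on the `τ`-eigenline of a CM quotient from the `ω`-isotypic part of a pinned Betti tower -/

open Literature.AlgebraicGeometry.Motives (CMType AbelianVariety IsSmoothProjective)
open Literature.AlgebraicGeometry.Motives.AbelianVariety (rationalTateModuleMap)
open Literature.AlgebraicGeometry.HodgeTheory (complexBetti IsOfHodgeType)
open Literature.AlgebraicGeometry.ComplexMultiplication (IsCMTypeRealisation)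
open Literature.NumberTheory.Automorphic (PicardCM.eigenline PicardCM.mem_eigenline_of_forall_integer)

/-- **Generic core of the transfer** ([Liu2021] proof of Thm. D.6 (1), p. 140, for ANY §4.2 datum `C`, translates `T`, induced étale Hecke
datum `X`, embedding `τ'`, field isomorphism `ι : ℂ ≅ ℚ̄_ℓ`, pinned Betti tower `(H, rhoB, b)`, `ℂ[𝔾]`-module `ω = (W, ρW)`, test
proposition `P` and level `K`).  HYPOTHESIS `hHodge`: every level class `y ∈ H¹_B(A_K ×_{τ'} ℂ)` with `b_K y` in the `ω`-isotypic part of `H`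
is of type `(1,0)` if `P` and `(0,1)` if `¬P`.  CONCLUSION: for `φ : A_K ⟶ B`, a number field `M` acting rationally on `B` with
`[M:ℚ] = 2 dim B`, `τ : M → ℂ`, and `f ∈ ℚ̄_ℓ ⊗ (V_ℓ B)^∨` on the `(ι ∘ τ)`-eigenline whose class `([·]_K ∘ ᵗV_ℓ φ) f` is non-zero and in the
span of the `ω`-block: on every `(B′, u′, v′, m, ρ, Φ)` transported from `(B, i)` and every realisation `θ` of `(B′ ×_{τ'} ℂ, ρ_ℂ)` of type `Φ`,
some non-zero `θ`-`τ`-eigenvector is of type `(1,0)` if `P` and `(0,1)` if `¬P`.  Proof: module docstring, steps 1–5.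
[cite: Liu2021, §4.2 (FJcycle.tex l. 2152–2168); proof of Thm. D.6 (1) p. 140] [cite: SGA4Tome3, Exp. XI Thm. 4.4]
[cite: Shimura1998, §5.2 (pp. 39–40)] [cite: Voisin2002, §7.3.2 and Cor. 6.14] -/
theorem exists_mem_eigenline_isOfHodgeType_of_isotypic {T : C.HeckeTranslates} (hX : X.IsInducedBy T) (τ' : E →+* ℂ)
    (Bp : C.BettiPinning T τ' H rhoB) {ρW : Representation ℂ C.G W} (P : Prop) (K : C5.SmallLevel C.S.K₀)
    (hHodge : ∀ y : C.bettiH1 τ' K,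
      Bp.b K y ∈ ⨆ ψ : Representation.IntertwiningMap ρW rhoB, LinearMap.range ψ.toLinearMap →
      letI : Algebra E ℂ := algebraAlong E τ'
      (P → IsOfHodgeType (C.A K).dim ((C.A K).baseChange ℂ).X 1 1 0 y) ∧
      (¬ P → IsOfHodgeType (C.A K).dim ((C.A K).baseChange ℂ).X 1 0 1 y)) :
    letI : Algebra E ℂ := τ'.toAlgebra
    ∀ {B : AbelianVariety E} (φ : C.A K ⟶ B)
      (M : Type) [Field M] [NumberField M] (i : M →+* B.endAlgebra),
      Module.finrank ℚ M = 2 * B.dim →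
      ∀ (τ : M →+* ℂ) (f : (AlgebraicClosure ℚ_[ℓ]) ⊗[ℚ_[ℓ]] Module.Dual ℚ_[ℓ] (B.rationalTateModule ℓ)),
        (∀ m : M, ((AbelianVariety.rationalTateAction B ℓ (i m)).dualMap).baseChange (AlgebraicClosure ℚ_[ℓ]) f = ι (τ m) • f) →
        ((C.toTower ℓ K ∘ₗ (AbelianVariety.rationalTateModuleMap ℓ φ).dualMap).baseChange (AlgebraicClosure ℚ_[ℓ])) f ≠ 0 →
        ((C.toTower ℓ K ∘ₗ (AbelianVariety.rationalTateModuleMap ℓ φ).dualMap).baseChange (AlgebraicClosure ℚ_[ℓ])) f ∈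
          Submodule.span (AlgebraicClosure ℚ_[ℓ]) {y | ∃ f ∈ X.omegaHom ι ρW, ∃ w : W, f w = y} →
        ∀ (B' : AbelianVariety E) (u' : B ⟶ B') (v' : B' ⟶ B) (m : ℕ) (hm : 0 < m)
          (huv : u' ≫ v' = m • 𝟙 B) (hvu : v' ≫ u' = m • 𝟙 B') (ρ : 𝓞 M →+* End B')
          (Φ : CMType M),
          (∀ a : 𝓞 M, AbelianVariety.endAlgebraTransport u' v' m hm huv hvu (i (a : M)) = AbelianVariety.endAlgebra.of B' (ρ a)) →
          ∀ (θ : M →+* Module.End ℂ (complexBetti (B'.baseChange ℂ).X 1)),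
            IsCMTypeRealisation Φ (B'.baseChange ℂ) ((B'.endBaseChange ℂ).comp ρ) θ →
            ∃ v ∈ PicardCM.eigenline θ τ, v ≠ 0 ∧
              (P → IsOfHodgeType (Module.finrank ℚ M / 2) (B'.baseChange ℂ).X 1 1 0 v) ∧
              (¬ P → IsOfHodgeType (Module.finrank ℚ M / 2) (B'.baseChange ℂ).X 1 0 1 v) := by
  intro B φ M _ _ i hdim τ f heig hy0 hyspan B' u' v' m hm huv hvu ρ Φ hcompat θ hreal
  classical
  letI : Algebra E ℂ := τ'.toAlgebra
  have hm' : (m : ℚ_[ℓ]) ≠ 0 := Nat.cast_ne_zero.2 hm.ne'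
  /- STEP 1: étale transport of the eigen-class to the principal model `B′` -/
  obtain ⟨f', hf'def⟩ : ∃ f' : AlgebraicClosure ℚ_[ℓ] ⊗[ℚ_[ℓ]] Module.Dual ℚ_[ℓ] (B'.rationalTateModule ℓ),
      ((rationalTateModuleMap ℓ v').dualMap).baseChange (AlgebraicClosure ℚ_[ℓ]) f = f' := ⟨_, rfl⟩
  have hf' : ∀ x : 𝓞 M, ((rationalTateModuleMap ℓ (ρ x : B' ⟶ B')).dualMap).baseChange (AlgebraicClosure ℚ_[ℓ]) f' =
      ι (τ (x : M)) • f' := by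
    intro x
    have hx := Sec42Data.dualMap_rationalTateAction_endAlgebraTransport_baseChange_eq_smul (ℓ := ℓ) u' v' m hm huv hvu
      (i (x : M)) (AlgebraicClosure ℚ_[ℓ]) (ι (τ (x : M))) f (heig (x : M))
    rwa [hcompat x, AbelianVariety.rationalTateAction_of, hf'def] at hx
  have huf' : ((rationalTateModuleMap ℓ u').dualMap).baseChange (AlgebraicClosure ℚ_[ℓ]) f' = (m : ℚ_[ℓ]) • f := by
    rw [← hf'def]
    exact Sec42Data.dualMap_baseChange_comp_of_comp_eq_nsmul (ℓ := ℓ) huv _ f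
  /- STEP 2: levelwise comparison family and the colimit comparison of the pinning -/
  obtain ⟨c⟩ := exists_h1ComparisonFamily_holds (E := E) τ' ℓ ι
  obtain ⟨cmp, hcmp⟩ := Bp.exists_bettiComparison c X hX
  /- STEP 3: the Betti class `y′ := c_{B′}⁻¹ f′`, a non-zero `θ`-`τ`-eigenvector -/
  obtain ⟨y', hy'⟩ := (c.bijective B').2 f'
  have hθ : ∀ a : 𝓞 M, θ (a : M) y' = τ (a : M) • y' := by
    intro a
    have e1 : θ (a : M) y' = bettiPullAlong τ' (ρ a : B' ⟶ B') y' := by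
      rw [← hreal.2.2.1 a]
      rfl
    apply (c.bijective B').1
    rw [e1, c.natural, hy', hf' a, LinearMap.map_smulₛₗ, hy']
    rfl
  have hmem : y' ∈ PicardCM.eigenline θ τ :=
    PicardCM.mem_eigenline_of_forall_integer θ τ hθ
  have hf'0 : f' ≠ 0 := by
    intro h0
    apply hy0
    have h1 : ((rationalTateModuleMap ℓ u').dualMap).baseChange (AlgebraicClosure ℚ_[ℓ]) f' = 0 := by
      rw [h0, map_zero]
    rw [huf'] at h1
    have hf0 : f = 0 := by rw [← inv_smul_smul₀ hm' f, h1, smul_zero]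
    rw [hf0, map_zero]
  have hy'0 : y' ≠ 0 := by
    rintro rfl
    exact hf'0 (by rw [← hy', map_zero])
  /- STEP 4: the level class `z := φ^* u′^* y′`; its comparison image is `m •` the class of `f` along `φ` -/
  obtain ⟨z, hzdef⟩ : ∃ z : C.bettiH1 τ' K, bettiPullAlong τ' φ (bettiPullAlong τ' u' y') = z := ⟨_, rfl⟩
  have hcz : c.cmp (C.A K) z =
      (m : ℚ_[ℓ]) • ((rationalTateModuleMap ℓ φ).dualMap).baseChange (AlgebraicClosure ℚ_[ℓ]) f := by
    rw [← hzdef, c.natural, c.natural, hy', huf', LinearMap.map_smul_of_tower]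
  have htz : (C.toTower ℓ K).baseChange (AlgebraicClosure ℚ_[ℓ]) (c.cmp (C.A K) z) =
      (m : ℚ_[ℓ]) • ((C.toTower ℓ K ∘ₗ (rationalTateModuleMap ℓ φ).dualMap).baseChange (AlgebraicClosure ℚ_[ℓ])) f := by
    rw [hcz, LinearMap.map_smul_of_tower, LinearMap.baseChange_comp, LinearMap.comp_apply]
  have hz0 : z ≠ 0 := by
    intro h0
    have h1 : c.cmp (C.A K) z = 0 := by
      rw [h0]
      exact (c.cmp (C.A K)).map_zero
    rw [hcz] at h1
    have h2 : ((rationalTateModuleMap ℓ φ).dualMap).baseChange (AlgebraicClosure ℚ_[ℓ]) f = 0 := by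
      rw [← inv_smul_smul₀ hm' (((rationalTateModuleMap ℓ φ).dualMap).baseChange (AlgebraicClosure ℚ_[ℓ]) f), h1, smul_zero]
    apply hy0
    rw [LinearMap.baseChange_comp, LinearMap.comp_apply, h2]
    exact ((C.toTower ℓ K).baseChange (AlgebraicClosure ℚ_[ℓ])).map_zero
  -- `b_K z` is `ω`-isotypic (its comparison image `m •` the class lies in the span of the block); read its type off `hHodge`
  have hHz := hHodge z (mem_iSup_range_of_cmp_eq_of_mem_span_blockValues cmp ρW
    (Submodule.smul_of_tower_mem _ (m : ℚ_[ℓ]) hyspan) (by rw [hcmp, htz]))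
  /- STEP 5: read-off — pull-backs preserve Hodge types; a non-zero class has one type -/
  have hX' : IsSmoothProjective (Module.finrank ℚ M / 2) (B'.baseChange ℂ).X := hreal.1
  have hXB : IsSmoothProjective (B.baseChange ℂ).dim (B.baseChange ℂ).X := AbelianVariety.isSmoothProjective_holds
  have hXK : IsSmoothProjective (C.A K).dim ((C.A K).baseChange ℂ).X := by
    rw [← AbelianVariety.dim_baseChange (C.A K) ℂ]
    exact AbelianVariety.isSmoothProjective_holds
  have htrans : ∀ p q : ℕ, IsOfHodgeType (Module.finrank ℚ M / 2) (B'.baseChange ℂ).X 1 p q y' →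
      IsOfHodgeType (C.A K).dim ((C.A K).baseChange ℂ).X 1 p q z := by
    intro p q hy
    have h1 := hy.map_of_isSmoothProjective hXB hX' (AbelianVariety.Hom.baseChange ℂ u').hom.hom.hom
    rw [← hzdef]
    exact h1.map_of_isSmoothProjective hXK hXB (AbelianVariety.Hom.baseChange ℂ φ).hom.hom.hom
  refine ⟨y', hmem, hy'0, fun hin => ?_, fun hout => ?_⟩
  · by_cases hτ : τ ∈ Φ.1
    · exact (hreal.2.2.2 τ).2.1 hτ y' hmem
    · exfalso
      exact hz0 (IsOfHodgeType.eq_zero_of_ne hXK (hHz.1 hin) (htrans 0 1 ((hreal.2.2.2 τ).2.2 hτ y' hmem)) (by decide))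
  · by_cases hτ : τ ∈ Φ.1
    · exfalso
      exact hz0 (IsOfHodgeType.eq_zero_of_ne hXK (htrans 1 0 ((hreal.2.2.2 τ).2.1 hτ y' hmem)) (hHz.2 hout) (by decide))
    · exact (hreal.2.2.2 τ).2.2 hτ y' hmem

end Generic

/-! ## §2 The transfer `S1PinningShape → S1bHodgeShape → S1bShape` -/

open scoped Matrix NumberField Kronecker ComplexOrder
open NumberField NumberField.InfinitePlace IsDedekindDomain
open CategoryTheory
open Summit.HodgeConjecture.CorCM.Model Summit.HodgeConjecture.CorCM.Model.HComp Summit.HodgeConjecture.CorCM.HComp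
open Literature.AlgebraicGeometry.Motives (CMType AbelianVariety IsSmoothProjective)
open Literature.AlgebraicGeometry.Motives.AbelianVariety (rationalTateModuleMap)
open Literature.AlgebraicGeometry.HodgeTheory (complexBetti IsOfHodgeType)
open Literature.AlgebraicGeometry.ShimuraVarieties.UnitaryCanonicalModel
open Literature.NumberTheory.Automorphic Literature.NumberTheory.Automorphic.UnitaryGroup
open Literature.NumberTheory.Automorphic.IdeleClassGroup Literature.NumberTheory.Automorphic.Liu2021 Literature.NumberTheory.Automorphic.Liu2021.AppendixC
open Literature.NumberTheory.GaloisRepresentations Literature.RepresentationTheory.Liu2021 Literature.RepresentationTheory.HarrisKudlaSweet1996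
open Literature.AlgebraicGeometry.Liu2021 (IsAdmissibleElement)
open Literature.NumberTheory.Weil1964 Literature.NumberTheory.GelbartRogawski1991 Literature.NumberTheory.GelbartRogawski1991.UnitaryDualPair Literature.NumberTheory.GelbartRogawski1991.UnitaryDualPair.WeilCoinv
open Literature.NumberTheory.GelbartRogawski1991.UnitaryDualPair.LocalSplitting
open Literature.NumberTheory.Automorphic.Liu2021.Def411WeilCarriersDoubling
open Literature.NumberTheory.Automorphic.Liu2021.Def411WeilCarriers (TW JW JW_eq isSymm_TW isUnit_det_TW Rep Eps epsOf Chi rhoVAtLine)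
open Summit.HodgeConjecture.CorCM (CMField)
open Summit.HodgeConjecture.CorCM.Lines.A3Liu418

/-- **B3 — the TRANSFER `S1PinningShape → S1bHodgeShape → S1bShape`** (PLAN-F0P5 v1 row 4; the two hypothesis types are the bodies of the
line's `S1PinningShape` ∕ `S1bHodgeShape` VERBATIM, the conclusion is the registered d6 letter ★ `S1bShape`).  See the module docstring for the
five-step proof (étale transport to the principal model, levelwise ∕ colimit comparison, Betti `θ`-eigen class, isotypic level class, Hodge-type
read-off). [cite: Liu2021, §4.2 (FJcycle.tex l. 2152–2168); Prop. D.4 (1) p. 130; Rem. D.5 p. 131; proof of Thm. D.6 (1) p. 140]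
[cite: SGA4Tome3, Exp. XI Thm. 4.4] [cite: Shimura1998, §5.2 (pp. 39–40)] [cite: Voisin2002, §7.3.2 and Cor. 6.14] -/
theorem stubS1bTransfer_holds :
    (
      ∀ (F : CMField) (ι₁ : F →+* ℂ) (Jstar : Matrix (Fin 2) (Fin 2) (F : Type))
        (K₀ : C5.OpenCompactSubgroup ↥(finAdelic ↥(maximalRealSubfield (F : Type)) (F : Type) (IsCMField.complexConj (F : Type)) 2 Jstar))
        (S : RecordSystemGS (F : Type) Jstar ι₁ K₀) (hU7ₛ : S.HeckeTranslateDefinedOver)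
        (h4 : 4 ≤ Module.finrank ℚ (F : Type)) (isoₛ : ℕ → Prop),
        ∃ (H : Type) (_ : AddCommGroup H) (_ : Module ℂ H) (rhoB : Representation ℂ (sec42DataGS S h4 isoₛ).G H),
          Nonempty ((sec42DataGS S h4 isoₛ).BettiPinning (sec42HeckeTranslatesGS S hU7ₛ h4 isoₛ) ι₁ H rhoB)) →
    (
      ∀ (F : CMField) [IsGalois ℚ F] (ι₁ : F →+* ℂ)
        (μ : Literature.NumberTheory.Automorphic.IdeleClassGroup (F : Type) →ₜ* Circle)
        (hμ : IdeleClassGroup.IsConjugateSymplectic (F : Type) μ)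
        (_hw : IdeleClassGroup.HasWeight (F : Type) μ 1)
        (Jstar : Matrix (Fin 2) (Fin 2) (F : Type)) (t : (F : Type)) (ht : t ≠ 0) (_hτt : 0 < (ι₁ t).re) (_hτt' : (ι₁ t).im = 0)
        (gstar : GL (Fin 2) (F : Type))
        (dJ : Fin 2 → (F : Type)) (hdJ : ∀ i, IsCMField.complexConj (F : Type) (dJ i) = dJ i) (hdJ0 : ∀ i, dJ i ≠ 0)
        (hg : formCongr ((IsCMField.complexConj (F : Type) : (F : Type) ≃ₐ[↥(maximalRealSubfield (F : Type))] (F : Type)) :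
            (F : Type) →+* (F : Type)) gstar (t • Jstar) = Matrix.diagonal dJ)
        (_hsig : (∃ Tstar : GL (Fin 2) ℂ,
            formCongr (starRingEnd ℂ) Tstar ((Matrix.diagonal dJ).map ι₁) = Matrix.diagonal ![(1 : ℂ), -1]) ∧
          ∀ τ' : (F : Type) →+* ℂ, InfinitePlace.mk τ' ≠ InfinitePlace.mk ι₁ → ((Matrix.diagonal dJ).map τ').PosDef)
        (K₀ : C5.OpenCompactSubgroup ↥(finAdelic ↥(maximalRealSubfield (F : Type)) (F : Type) (IsCMField.complexConj (F : Type)) 2 Jstar))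
        (S : RecordSystemGS (F : Type) Jstar ι₁ K₀) (hU7ₛ : S.HeckeTranslateDefinedOver)
        (h4 : 4 ≤ Module.finrank ℚ (F : Type)) (isoₛ : ℕ → Prop)
        (r : Rep ↥(maximalRealSubfield (F : Type)) (imagUnitSq F))
        (ε : Eps ↥(maximalRealSubfield (F : Type)) (imagUnitSq F))
        (_hadm : ∃ e : (F : Type), IsAdmissibleElement (F : Type) hμ.cmType.1 e ∧
          epsOf ↥(maximalRealSubfield (F : Type)) (imagUnitSq F) (F : Type) (2 * imagUnit (F : Type))⁻¹ (-e) = ε)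
        (χ : Chi ↥(maximalRealSubfield (F : Type)) (F : Type) (IsCMField.complexConj (F : Type)))
        (H : Type) [AddCommGroup H] [Module ℂ H] (rhoB : Representation ℂ (sec42DataGS S h4 isoₛ).G H)
        (B : (sec42DataGS S h4 isoₛ).BettiPinning (sec42HeckeTranslatesGS S hU7ₛ h4 isoₛ) ι₁ H rhoB)
        (K : C5.SmallLevel K₀) (y : (sec42DataGS S h4 isoₛ).bettiH1 ι₁ K),
        B.b K y ∈ ⨆ ψ : Representation.IntertwiningMap (G := (sec42DataGS S h4 isoₛ).G)
            ((rhoVAtLine ↥(maximalRealSubfield (F : Type)) (F : Type) (IsCMField.complexConj (F : Type)) 2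
              (finProdFinEquiv : Fin 2 × Fin 1 ≃ Fin (2 * 1)) (Matrix.diagonal dJ)
              (complexConj_imagUnit F) (imagUnit_ne_zero F) (imagUnit_mul_self F) (realDiagonal_isSymm F dJ hdJ)
              (isUnit_det_realDiagonal F dJ hdJ hdJ0) (realDiagonal_map F dJ hdJ).symm
              (hsChiGS F finProdFinEquiv dJ hdJ hdJ0
                (toHeckeCharacter (F : Type) (galConj (IsCMField.complexConj (F : Type)) μ))
                (isUnitary_toHeckeCharacter (F : Type) (galConj (IsCMField.complexConj (F : Type)) μ))
                ((isOscillatorChar_toHeckeCharacter_iff (galConj (IsCMField.complexConj (F : Type)) μ)).mpr hμ.galConj))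
              (r.toFun ε) χ).comp
              (finAdelicCongr ↥(maximalRealSubfield (F : Type)) (F : Type) (IsCMField.complexConj (F : Type)) gstar ht hg).symm.toMonoidHom)
            rhoB, LinearMap.range ψ.toLinearMap →
        letI : Algebra (F : Type) ℂ := algebraAlong (F : Type) ι₁
        (ι₁ ∈ hμ.cmType.1 →
          Literature.AlgebraicGeometry.HodgeTheory.IsOfHodgeType ((sec42DataGS S h4 isoₛ).A K).dim
            (((sec42DataGS S h4 isoₛ).A K).baseChange ℂ).X 1 1 0 y) ∧
        (ι₁ ∉ hμ.cmType.1 →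
          Literature.AlgebraicGeometry.HodgeTheory.IsOfHodgeType ((sec42DataGS S h4 isoₛ).A K).dim
            (((sec42DataGS S h4 isoₛ).A K).baseChange ℂ).X 1 0 1 y)) →
    (∀ (F : CMField) [IsGalois ℚ F] (ι₁ : F →+* ℂ)
      (μ : Literature.NumberTheory.Automorphic.IdeleClassGroup (F : Type) →ₜ* Circle)
      (hμ : IdeleClassGroup.IsConjugateSymplectic (F : Type) μ)
      (_hw : IdeleClassGroup.HasWeight (F : Type) μ 1)
      (ℓ : ℕ) [Fact ℓ.Prime] (ι' : ℂ ≃+* AlgebraicClosure ℚ_[ℓ])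
      (Jstar : Matrix (Fin 2) (Fin 2) (F : Type)) (t : (F : Type)) (ht : t ≠ 0) (_hτt : 0 < (ι₁ t).re) (_hτt' : (ι₁ t).im = 0)
      (gstar : GL (Fin 2) (F : Type))
      (dJ : Fin 2 → (F : Type)) (hdJ : ∀ i, IsCMField.complexConj (F : Type) (dJ i) = dJ i) (hdJ0 : ∀ i, dJ i ≠ 0)
      (hg : formCongr ((IsCMField.complexConj (F : Type) : (F : Type) ≃ₐ[↥(maximalRealSubfield (F : Type))] (F : Type)) :
          (F : Type) →+* (F : Type)) gstar (t • Jstar) = Matrix.diagonal dJ)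
      (_hsig : (∃ Tstar : GL (Fin 2) ℂ,
          formCongr (starRingEnd ℂ) Tstar ((Matrix.diagonal dJ).map ι₁) = Matrix.diagonal ![(1 : ℂ), -1]) ∧
        ∀ τ' : (F : Type) →+* ℂ, InfinitePlace.mk τ' ≠ InfinitePlace.mk ι₁ → ((Matrix.diagonal dJ).map τ').PosDef)
      (K₀ : C5.OpenCompactSubgroup ↥(finAdelic ↥(maximalRealSubfield (F : Type)) (F : Type) (IsCMField.complexConj (F : Type)) 2 Jstar))
      (S : RecordSystemGS (F : Type) Jstar ι₁ K₀) (hU7ₛ : S.HeckeTranslateDefinedOver) (hLQ : S.IsLevelQuotient)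
      (h4 : 4 ≤ Module.finrank ℚ (F : Type)) (isoₛ : ℕ → Prop)
      (r : Rep ↥(maximalRealSubfield (F : Type)) (imagUnitSq F))
      (ε : Eps ↥(maximalRealSubfield (F : Type)) (imagUnitSq F))
      (_hadm : ∃ e : (F : Type), IsAdmissibleElement (F : Type) hμ.cmType.1 e ∧
        epsOf ↥(maximalRealSubfield (F : Type)) (imagUnitSq F) (F : Type) (2 * imagUnit (F : Type))⁻¹ (-e) = ε)
      (χ : Chi ↥(maximalRealSubfield (F : Type)) (F : Type) (IsCMField.complexConj (F : Type))),
      letI : Algebra (F : Type) ℂ := ι₁.toAlgebra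
      ∀ (K : C5.SmallLevel K₀) {B : Literature.AlgebraicGeometry.Motives.AbelianVariety (F : Type)} (φ : (sec42DataGS S h4 isoₛ).A K ⟶ B)
        (M : Type) [Field M] [NumberField M] [IsCMField M] (i : M →+* B.endAlgebra),
        Module.finrank ℚ M = 2 * B.dim →
        ∀ (τ : M →+* ℂ) (f : (AlgebraicClosure ℚ_[ℓ]) ⊗[ℚ_[ℓ]] Module.Dual ℚ_[ℓ] (B.rationalTateModule ℓ)),
          (∀ m : M, ((AbelianVariety.rationalTateAction B ℓ (i m)).dualMap).baseChange (AlgebraicClosure ℚ_[ℓ]) f = ι' (τ m) • f) →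
          (((sec42DataGS S h4 isoₛ).toTower ℓ K ∘ₗ (AbelianVariety.rationalTateModuleMap ℓ φ).dualMap).baseChange (AlgebraicClosure ℚ_[ℓ])) f ≠ 0 →
          (((sec42DataGS S h4 isoₛ).toTower ℓ K ∘ₗ (AbelianVariety.rationalTateModuleMap ℓ φ).dualMap).baseChange (AlgebraicClosure ℚ_[ℓ])) f ∈
            Submodule.span (AlgebraicClosure ℚ_[ℓ]) {y | ∃ f ∈ (etaleHeckeDatumGS S hU7ₛ hLQ h4 isoₛ ℓ).omegaHom ι'
              ((rhoVAtLine ↥(maximalRealSubfield (F : Type)) (F : Type) (IsCMField.complexConj (F : Type)) 2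
            (finProdFinEquiv : Fin 2 × Fin 1 ≃ Fin (2 * 1)) (Matrix.diagonal dJ)
            (complexConj_imagUnit F) (imagUnit_ne_zero F) (imagUnit_mul_self F) (realDiagonal_isSymm F dJ hdJ)
            (isUnit_det_realDiagonal F dJ hdJ hdJ0) (realDiagonal_map F dJ hdJ).symm
            (hsChiGS F finProdFinEquiv dJ hdJ hdJ0
              (toHeckeCharacter (F : Type) (galConj (IsCMField.complexConj (F : Type)) μ))
              (isUnitary_toHeckeCharacter (F : Type) (galConj (IsCMField.complexConj (F : Type)) μ))
              ((isOscillatorChar_toHeckeCharacter_iff (galConj (IsCMField.complexConj (F : Type)) μ)).mpr hμ.galConj))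
            (r.toFun ε) χ).comp
            (finAdelicCongr ↥(maximalRealSubfield (F : Type)) (F : Type) (IsCMField.complexConj (F : Type)) gstar ht hg).symm.toMonoidHom),
              ∃ w, f w = y} →
          ∀ (B' : Literature.AlgebraicGeometry.Motives.AbelianVariety (F : Type)) (u' : B ⟶ B') (v' : B' ⟶ B) (m : ℕ) (hm : 0 < m)
            (huv : u' ≫ v' = m • 𝟙 B) (hvu : v' ≫ u' = m • 𝟙 B') (ρ : 𝓞 M →+* End B')
            (Φ : Literature.AlgebraicGeometry.Motives.CMType M),
            AbelianVariety.IsIsogeny u' →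
            (∀ a : 𝓞 M, AbelianVariety.endAlgebraTransport u' v' m hm huv hvu (i (a : M)) = AbelianVariety.endAlgebra.of B' (ρ a)) →
            ∀ (θ : M →+* Module.End ℂ (Literature.AlgebraicGeometry.HodgeTheory.complexBetti (B'.baseChange ℂ).X 1)),
              Literature.AlgebraicGeometry.ComplexMultiplication.IsCMTypeRealisation Φ (B'.baseChange ℂ) ((B'.endBaseChange ℂ).comp ρ) θ →
              ∃ v ∈ Literature.NumberTheory.Automorphic.PicardCM.eigenline θ τ, v ≠ 0 ∧
                (ι₁ ∈ hμ.cmType.1 →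
                  Literature.AlgebraicGeometry.HodgeTheory.IsOfHodgeType (Module.finrank ℚ M / 2) (B'.baseChange ℂ).X 1 1 0 v) ∧
                (ι₁ ∉ hμ.cmType.1 →
                  Literature.AlgebraicGeometry.HodgeTheory.IsOfHodgeType (Module.finrank ℚ M / 2) (B'.baseChange ℂ).X 1 0 1 v)) := by
  intro hP hH F _ ι₁ μ hμ hw ℓ _ ι' Jstar t ht hτt hτt' gstar dJ hdJ hdJ0 hg hsig K₀ S hU7ₛ hLQ h4 isoₛ r ε hadm χ K B φ
    M _ _ _ i hdim τ f heig hy0 hyspan B' u' v' m hm huv hvu ρ Φ _ hcompat θ hreal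
  obtain ⟨H, _, _, rhoB, ⟨Bp⟩⟩ := hP F ι₁ Jstar K₀ S hU7ₛ h4 isoₛ
  exact exists_mem_eigenline_isOfHodgeType_of_isotypic
    (isInducedBy_etaleHeckeDatumGS S hU7ₛ hLQ h4 isoₛ ℓ) ι₁ Bp (ι₁ ∈ hμ.cmType.1) K
    (fun y hy => hH F ι₁ μ hμ hw Jstar t ht hτt hτt' gstar dJ hdJ hdJ0 hg hsig K₀ S hU7ₛ h4 isoₛ r ε hadm χ H rhoB Bp K y hy)
    φ M i hdim τ f heig hy0 hyspan B' u' v' m hm huv hvu ρ Φ hcompat θ hreal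

end Summit.HodgeConjecture.HodgeConjecture.Cruxes.HLiu418.F0P5StubS1bTransfer
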